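import Literature.AlgebraicGeometry.Motives.GrassmannianSchemeProper
import Mathlib.AlgebraicGeometry.ZariskisMainTheorem
import HarnessLib

/-!
# Monomorphisms between Grassmannian schemes: from injectivity on affine points to closed immersions

Topic `AlgebraicGeometry/Motives`; namespace `Literature.AlgebraicGeometry.Motives` (§1, generic) and
`Literature.AlgebraicGeometry.Motives.Grassmannian` (§2).  THEOREMS ONLY (no definition, no instance, no notation, no named
fact, no `sorry`).  (h4) brick (A12), the seam lemma for morphisms OUT OF a Grassmannian scheme constructed from their functor
of points (Plücker `Gr(k, M) → Gr(1, ⋀ᵏM)`, functoriality `Gr(k, M′) → Gr(k, M)` along `M ↠ M′`, …):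

* §1 **`mono_of_injective_comp_of_isAffine`**, **`mono_of_injective_comp_Spec`** — a morphism of schemes `f : X ⟶ Y` such
  that `g ↦ g ≫ f` is injective on `T`-points for every AFFINE `T` (resp. every `Spec A`) is a monomorphism (Zariski descent of
  equality of morphisms, Mathlib `Scheme.Cover.hom_ext` on `T.affineCover`).
* §2 for `φ : grassmannianScheme M k ⟶ grassmannianScheme M′ k′`: **`Grassmannian.mono_of_injective_specPoints`** (injective on
  `Module.Grassmannian` points `specPointsEquiv … (g ≫ φ)` for all rings ⇒ `Mono φ`), **`Grassmannian.isProper_of_isSeparated_target`**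
  / **`isClosedImmersion_of_mono_of_isSeparated_target`** (ANY target separated over `ℤ`, e.g. a projective space — the Plücker /
  `Gr(1, L) ↪ 𝒫` shape), **`Grassmannian.isProper_hom`** (any morphism between Grassmannians of finite free modules is proper: ★ (A7)
  `isProper_terminal_from` + Mathlib `IsProper.of_comp` against the separated target), and **`Grassmannian.isClosedImmersion_of_mono`** /
  **`isClosedImmersion_of_injective_specPoints`** — «proper monomorphism ⇒ closed immersion» (Mathlib
  `IsClosedImmersion.iff_isProper_and_mono`, [StacksProject, Tag 04XV]); this is the scheme half of «the Plücker map is a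
  closed immersion» once its injectivity on affine points is known.

Cell `hodgecm-mathlib` (D-0151), count-neutral Mathlib-side capital; nothing here is about HC — HC_CM is proved only modulo the 7
printed citations until rung 0 closes.
-/

universe u

open CategoryTheory CategoryTheory.Limits Opposite _root_.AlgebraicGeometry

namespace Literature.AlgebraicGeometry.Motives

/-! ## §1 Monomorphisms of schemes are detected on affine test schemes -/

/-- **A morphism of schemes injective on `T`-points for all affine `T` is a monomorphism** (equality of two morphisms
`T ⟶ X` is Zariski-local on `T` — gluing of morphisms; Mathlib `Scheme.Cover.hom_ext` for the affine cover).
[cite: GortzWedhorn2020, Section (3.3) Prop. 3.5] -/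
theorem mono_of_injective_comp_of_isAffine {X Y : Scheme.{u}} (f : X ⟶ Y)
    (h : ∀ (T : Scheme.{u}) [IsAffine T], Function.Injective fun g : T ⟶ X => g ≫ f) : Mono f := by
  refine ⟨fun {T} g₁ g₂ hg => ?_⟩
  refine Scheme.Cover.hom_ext T.affineCover g₁ g₂ fun i => ?_
  haveI : IsAffine (T.affineCover.X i) := Scheme.isAffine_affineCover T i
  apply h (T.affineCover.X i)
  change (T.affineCover.f i ≫ g₁) ≫ f = (T.affineCover.f i ≫ g₂) ≫ f
  rw [Category.assoc, Category.assoc, hg]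

/-- **A morphism of schemes injective on `Spec A`-points for all rings `A` is a monomorphism.** [cite: GortzWedhorn2020, Section (3.3) Prop. 3.5] -/
theorem mono_of_injective_comp_Spec {X Y : Scheme.{u}} (f : X ⟶ Y)
    (h : ∀ (A : CommRingCat.{u}), Function.Injective fun g : Spec A ⟶ X => g ≫ f) : Mono f := by
  refine mono_of_injective_comp_of_isAffine f fun T _ g₁ g₂ hg => ?_
  have hg' : g₁ ≫ f = g₂ ≫ f := hg
  have h' : T.isoSpec.inv ≫ g₁ = T.isoSpec.inv ≫ g₂ :=
    h Γ(T, ⊤) (by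
      change (T.isoSpec.inv ≫ g₁) ≫ f = (T.isoSpec.inv ≫ g₂) ≫ f
      rw [Category.assoc, Category.assoc, hg'])
  exact (cancel_epi T.isoSpec.inv).mp h'

namespace Grassmannian

/-! ## §2 Morphisms between Grassmannian schemes -/

section Mono

variable {M : Type u} [AddCommGroup M] {k : ℕ} [(grassmannianSheaf M k).obj.IsRepresentable]
  {M' : Type u} [AddCommGroup M'] {k' : ℕ} [(grassmannianSheaf M' k').obj.IsRepresentable]

/-- **A morphism of Grassmannian schemes injective on `Module.Grassmannian` points is a monomorphism**: if
`g ↦ specPointsEquiv (g ≫ φ) ∈ G(k′, A ⊗ M′; A)` is injective on `Spec A`-points for every ring `A`, then `Mono φ`.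
[cite: GortzWedhorn2020, Section (3.3) Prop. 3.5] [cite: GortzWedhorn2020, (8.4) (pp. 213–215)] -/
theorem mono_of_injective_specPoints (φ : grassmannianScheme M k ⟶ grassmannianScheme M' k')
    (h : ∀ (A : CommRingCat.{u}),
      Function.Injective fun g : Spec A ⟶ grassmannianScheme M k => specPointsEquiv M' k' A (g ≫ φ)) :
    Mono φ :=
  mono_of_injective_comp_Spec φ fun A g₁ g₂ hg => h A (by simp only [hg])

variable (M k)
variable [Module.Finite ℤ M] [Module.Free ℤ M]

/-- **Every morphism from the Grassmannian scheme of a finite free module to a scheme separated over `ℤ` is proper**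
(source proper over `ℤ` by ★ `isProper_terminal_from`; Mathlib `IsProper.of_comp`) — e.g. into another Grassmannian, or into
a projective space `𝒫(ι; ⊤)`. [cite: GortzWedhorn2020, Example 15.12 (Section (15.2), pp. 494–497)] -/
theorem isProper_of_isSeparated_target {Y : Scheme.{u}} [IsSeparated (terminal.from Y)] (φ : grassmannianScheme M k ⟶ Y) :
    IsProper φ := by
  haveI : IsProper (φ ≫ terminal.from Y) := by
    rw [terminal.comp_from]
    exact isProper_terminal_from M k
  exact IsProper.of_comp φ (terminal.from Y)

/-- **A monomorphism from the Grassmannian scheme of a finite free module to a scheme separated over `ℤ` is a closed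
immersion** («proper monomorphism ⇒ closed immersion», Mathlib `IsClosedImmersion.iff_isProper_and_mono`).
[cite: StacksProject, Tag 04XV] [cite: GortzWedhorn2020, Example 15.12 (Section (15.2), pp. 494–497)] -/
theorem isClosedImmersion_of_mono_of_isSeparated_target {Y : Scheme.{u}} [IsSeparated (terminal.from Y)]
    (φ : grassmannianScheme M k ⟶ Y) [Mono φ] : IsClosedImmersion φ := by
  haveI := isProper_of_isSeparated_target M k φ
  exact (IsClosedImmersion.iff_isProper_and_mono φ).mpr ⟨inferInstance, inferInstance⟩

variable (M' k')
variable [Module.Finite ℤ M'] [Module.Free ℤ M']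

/-- **Every morphism between Grassmannian schemes of finite free modules is proper.**
[cite: GortzWedhorn2020, Example 15.12 (Section (15.2), pp. 494–497)] -/
theorem isProper_hom (φ : grassmannianScheme M k ⟶ grassmannianScheme M' k') : IsProper φ := by
  haveI := isSeparated_terminal_from M' k'
  exact isProper_of_isSeparated_target M k φ

/-- **A monomorphism between Grassmannian schemes of finite free modules is a closed immersion.** [cite: StacksProject, Tag 04XV]
[cite: GortzWedhorn2020, Example 15.12 (Section (15.2), pp. 494–497)] -/
theorem isClosedImmersion_of_mono (φ : grassmannianScheme M k ⟶ grassmannianScheme M' k') [Mono φ] :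
    IsClosedImmersion φ := by
  haveI := isSeparated_terminal_from M' k'
  exact isClosedImmersion_of_mono_of_isSeparated_target M k φ

/-- **From injectivity on affine points to a closed immersion**: a morphism of Grassmannian schemes of finite free modules
which is injective on `Module.Grassmannian` points of every ring is a closed immersion — the scheme half of «the Plücker map
is a closed immersion» and of «`Gr(k, M′) ↪ Gr(k, M)` for `M ↠ M′`». [cite: StacksProject, Tag 04XV]
[cite: GortzWedhorn2020, Example 15.12 (Section (15.2), pp. 494–497)] -/
theorem isClosedImmersion_of_injective_specPoints (φ : grassmannianScheme M k ⟶ grassmannianScheme M' k')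
    (h : ∀ (A : CommRingCat.{u}),
      Function.Injective fun g : Spec A ⟶ grassmannianScheme M k => specPointsEquiv M' k' A (g ≫ φ)) :
    IsClosedImmersion φ := by
  haveI := mono_of_injective_specPoints φ h
  exact isClosedImmersion_of_mono M k M' k' φ

end Mono

end Grassmannian

end Literature.AlgebraicGeometry.Motives
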